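import Literature.AlgebraicGeometry.ShimuraVarieties.KudlaRapoport2013.Sec3ComplexUniformization
import Mathlib.NumberTheory.NumberField.ClassNumber
import Mathlib.NumberTheory.RamificationInertia.Galois
import Mathlib.NumberTheory.RamificationInertia.Inertia
import Mathlib.RingTheory.DedekindDomain.Factorization
import Mathlib.FieldTheory.Galois.IsGaloisGroup
import Mathlib.RingTheory.Ideal.Pointwise
import HarnessLib

/-!
# [KudlaRapoport2013, §3.3 (3.4) (arXiv v2 p. 18)] «`L_𝔞` is again a self-dual lattice, `L_𝔞 ≃ Hom_{O_k}(L_{0,𝔞⁻¹}, L)`» —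
# DISCHARGED: `KR2013_3_eq_3_4_holds`

Kernel-lane companion of the statement carpet ★
`Literature/AlgebraicGeometry/ShimuraVarieties/KudlaRapoport2013/Sec3ComplexUniformization.lean`: its CLOSED named fact ★
`KR2013_3_eq_3_4` — S. Kudla, M. Rapoport, *Special cycles on unitary Shimura varieties II: global theory*, J. reine angew.
Math. 697 (2014), §3.3, display (3.4) (arXiv:0912.3758v2 p. 18): «For a fractional ideal `𝔞` and for a hermitian lattice `L`
with hermitian form `( , )` we let `L_𝔞 = 𝔞 ⊗ L` with `(x, x)_𝔞 = (x, x)/N(𝔞)` (3.3).  Then, `L_𝔞` is again a self-dual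
lattice, `L_𝔞 ≃ Hom_{O_k}(L_{0,𝔞⁻¹}, L)` (3.4) as hermitian lattices» — typed as three conjuncts: (i) `x̃ ∈ Hom_{O_k}(L_{0,𝔞⁻¹}, L)
⇔ x̃(1) ∈ 𝔞 L`; (ii) `h̃(x̃, ỹ) = (x̃(1), ỹ(1))_𝔞`; (iii) `(J, L)` self-dual ⇒ `(N(𝔞)⁻¹ J, 𝔞 L)` self-dual — is PROVED here.
THEOREMS ONLY (no definition, no named fact, no `sorry`, no instance, no notation); cell hodgecm-mathlib, seat B-typ04 (g31);
net debt −1.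

## The proof

* (i) `mem_twistLattice_iff`: `v ∈ 𝔞 L ⇔ 𝔞⁻¹ v ⊆ L`, from `𝔞 𝔞⁻¹ = O_k` (`Units.mul_inv` in the group of invertible
  fractional ideals and `FractionalIdeal.mul_induction_on`); `x̃ ↦ x̃(1)` turns `x̃(L_{0,𝔞⁻¹}) ⊆ L` into `𝔞⁻¹ x̃(1) ⊆ L`.
* (ii) `(1, 1)_{V_{0,𝔞⁻¹}} = N(𝔞⁻¹)⁻¹ = N(𝔞)` (`map_inv₀` for Mathlib's multiplicative `FractionalIdeal.absNorm`).
* (iii) rests on the quadratic-field identity **`I · I^σ = (N I)`** (`mul_smul_eq_span_absNorm`; Cox, *Primes of the form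
  x² + ny²*, Lemma 7.14 (i) «`a ā = N(a) O`»): for a prime `𝔭 ∣ p` it is the `e f g = 2` trichotomy (`p O_k = 𝔭 𝔭^σ`, or `= 𝔭²`,
  or `= 𝔭` with `N𝔭 = p²`), read off Mathlib's `Ideal.ncard_primesOver_mul_ramificationIdxIn_mul_inertiaDegIn`, the
  transitivity `Ideal.exists_smul_eq_of_isGaloisGroup` and `Ideal.absNorm_eq_pow_inertiaDeg'` — the same road as the tree's ★
  `QuadraticFields.ConjugateIdealClass.mk0_mul_mk0_smul_eq_one`; general ideals by induction on the prime factorisation.  Writing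
  `𝔞 = c I` (`FractionalIdeal.exists_eq_spanSingleton_mul`) with `c σ(c) = N_{k/ℚ}(c)` (`mul_conj_eq_norm`, `Gal(k/ℚ) = {1, σ}`)
  gives `N(𝔞) = ± c σ(c) N(I)`; hence `(a l, b m)/N(𝔞) = a σ(b) (l, m)/N(𝔞) ∈ O_k` for `a, b ∈ 𝔞`, `l, m ∈ L` (`𝔞 L ⊆ (𝔞 L)^∨`),
  and conversely if `(x, 𝔞 L) ⊆ N(𝔞) O_k` then for `u ∈ 𝔞⁻¹` one has `u c N(I) ∈ σ(I)` (`exists_mul_absNorm_eq_conj`, from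
  `N(I) ∈ I I^σ`), so `u (x, l) = ± (x, c j l)/N(𝔞) ∈ O_k` for all `l ∈ L`, i.e. `u x ∈ L^∨ = L`, i.e. `x ∈ 𝔞 L` by (i).
  The hypotheses «`J` hermitian» and «`L` of full rank» of the typed conjunct are not needed.

## References
* [KudlaRapoport2013] S. Kudla, M. Rapoport, *Special cycles on unitary Shimura varieties II: global theory*, J. reine angew.
  Math. 697 (2014) 91–157; arXiv:0912.3758v2, §3.2 (3.1), §3.3 (3.3)–(3.4) (pp. 16–18).
* [Cox2013] D. A. Cox, *Primes of the form x² + ny²*, 2nd ed., Wiley 2013, §7.B Lemma 7.14.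
* [Marcus2018] D. A. Marcus, *Number Fields*, 2nd ed., Springer 2018, Ch. 3, Thm. 25 (splitting of primes in quadratic fields).
-/

set_option autoImplicit false

noncomputable section

open NumberField IsDedekindDomain Module
open Literature.NumberTheory.Automorphic.Liu2021.AppendixC (conj conj_ne_one)
open scoped nonZeroDivisors Pointwise Matrix

namespace Literature.AlgebraicGeometry.ShimuraVarieties.KudlaRapoport2013.Sec3ComplexUniformization

section ConjNorm

variable {K : Type} [Field K] [NumberField K]

/-- In a group of order `2` with a non-trivial element `τ`, every element is `1` or `τ`. [folklore] -/
private theorem eq_one_or_eq_of_card_two {G : Type*} [Group G] (hG : Nat.card G = 2) {τ : G}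
    (hτ : τ ≠ 1) (σ : G) : σ = 1 ∨ σ = τ := by
  haveI : Finite G := Nat.finite_of_card_ne_zero (by rw [hG]; norm_num)
  have hsub : ({1, τ} : Set G) = Set.univ := by
    apply Set.eq_of_subset_of_ncard_le (Set.subset_univ _)
    rw [Set.ncard_univ, hG, Set.ncard_pair hτ.symm]
  have : σ ∈ ({1, τ} : Set G) := by rw [hsub]; exact Set.mem_univ σ
  simpa using this

/-- **`𝔭 · 𝔭^τ = (N𝔭)` for a prime of a quadratic field** (`e f g = 2`: `p O_K = 𝔭 𝔭^τ` if `𝔭^τ ≠ 𝔭`, else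
`p O_K = 𝔭^e` with `(e, f) = (2, 1)` or `(1, 2)`; in each case `𝔭 𝔭^τ = (p^f) = (N𝔭)`).
[cite: Cox2013, §7.B Lemma 7.14] [cite: Marcus2018, Ch. 3, Thm. 25] -/
private theorem prime_mul_smul_eq_span_absNorm (h2 : finrank ℚ K = 2) (τ : K ≃ₐ[ℚ] K) (hτ : τ ≠ 1)
    (P : Ideal (𝓞 K)) [hPp : P.IsPrime] (hP0 : P ≠ ⊥) :
    P * τ • P = Ideal.span {((Ideal.absNorm P : ℕ) : 𝓞 K)} := by
  classical
  haveI : Algebra.IsQuadraticExtension ℚ K := ⟨h2⟩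
  haveI : IsGaloisGroup (K ≃ₐ[ℚ] K) ℤ (𝓞 K) :=
    IsGaloisGroup.of_isFractionRing (K ≃ₐ[ℚ] K) ℤ (𝓞 K) ℚ K
  have hG : Nat.card (K ≃ₐ[ℚ] K) = 2 := by rw [IsGalois.card_aut_eq_finrank, h2]
  haveI hPmax : P.IsMaximal := hPp.isMaximal hP0
  set p : Ideal ℤ := P.under ℤ with hpdef
  haveI : p.IsMaximal := Ideal.IsMaximal.under ℤ P
  have hp0 : p ≠ ⊥ := mt Ideal.eq_bot_of_comap_eq_bot hP0
  have hPover : P ∈ p.primesOver (𝓞 K) := ⟨hPp, ⟨rfl⟩⟩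
  haveI : P.LiesOver p := hPover.2
  -- the rational prime `q` below `P`
  obtain ⟨p₀, hp₀⟩ := (IsPrincipalIdealRing.principal p).principal
  rw [Ideal.submodule_span_eq] at hp₀
  set q : ℕ := p₀.natAbs with hq
  have hpq : p = Ideal.span {(q : ℤ)} := by rw [hp₀, hq, Int.span_natAbs]
  have hp₀ne : p₀ ≠ 0 := by
    rintro rfl
    apply hp0
    rw [hp₀, Ideal.span_singleton_eq_bot]
  have hqprime : q.Prime := by
    have hprime : Prime p₀ := (Ideal.span_singleton_prime hp₀ne).mp (hp₀ ▸ (inferInstance : p.IsMaximal).isPrime)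
    exact Int.prime_iff_natAbs_prime.mp hprime
  haveI : P.LiesOver (Ideal.span {(q : ℤ)}) := ⟨by rw [← hpq]⟩
  haveI : (Ideal.span {(q : ℤ)}).IsMaximal := by rw [← hpq]; infer_instance
  -- `N P = q ^ f`, `f = inertiaDegIn`
  have hN : Ideal.absNorm P = q ^ p.inertiaDegIn (𝓞 K) := by
    rw [Ideal.absNorm_eq_pow_inertiaDeg' P hqprime, Ideal.inertiaDeg'_eq_inertiaDeg (Ideal.span {(q : ℤ)}) P,
      Ideal.inertiaDegIn_eq_inertiaDeg p P (K ≃ₐ[ℚ] K)]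
  -- `q O_K = ∏ Q ^ e`
  have hfac := Ideal.map_algebraMap_eq_finsetProd_pow (R := 𝓞 K) hp0
  have hmapq : p.map (algebraMap ℤ (𝓞 K)) = Ideal.span {(q : 𝓞 K)} := by
    rw [hpq, Ideal.map_span, Set.image_singleton, map_natCast]
  -- `e f g = 2`
  have hefg := Ideal.ncard_primesOver_mul_ramificationIdxIn_mul_inertiaDegIn p (𝓞 K) (K ≃ₐ[ℚ] K)
  rw [hG] at hefg
  have hein : ∀ Q ∈ p.primesOver (𝓞 K), Q.ramificationIdx ℤ = p.ramificationIdxIn (𝓞 K) := by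
    intro Q hQ
    haveI := hQ.1
    haveI := hQ.2
    exact (Ideal.ramificationIdxIn_eq_ramificationIdx p Q (K ≃ₐ[ℚ] K)).symm
  have he0 : p.ramificationIdxIn (𝓞 K) ≠ 0 := Ideal.ramificationIdxIn_ne_zero (K ≃ₐ[ℚ] K)
  have hf0 : p.inertiaDegIn (𝓞 K) ≠ 0 := Ideal.inertiaDegIn_ne_zero (K ≃ₐ[ℚ] K)
  -- every prime above `p` is `P` or `τ • P`
  have hconj : ∀ Q ∈ p.primesOver (𝓞 K), Q = P ∨ Q = τ • P := by
    intro Q hQ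
    haveI := hQ.1
    haveI := hQ.2
    obtain ⟨σ, rfl⟩ := Ideal.exists_smul_eq_of_isGaloisGroup p P Q (K ≃ₐ[ℚ] K)
    rcases eq_one_or_eq_of_card_two hG hτ σ with h | h
    · exact Or.inl (by rw [h, one_smul])
    · exact Or.inr (by rw [h])
  have hτP : τ • P ∈ p.primesOver (𝓞 K) := by
    have hprime : (τ • P).IsPrime := Ideal.IsPrime.smul τ
    refine ⟨hprime, ⟨?_⟩⟩
    rw [Ideal.under_smul]
  rw [hN, Nat.cast_pow, ← Ideal.span_singleton_pow, ← hmapq]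
  by_cases hfix : τ • P = P
  · -- `q O_K = P ^ e`, `e f = 2`
    have hset : p.primesOver (𝓞 K) = {P} := by
      ext Q
      simp only [Set.mem_singleton_iff]
      constructor
      · intro hQ
        rcases hconj Q hQ with h | h
        · exact h
        · rw [h, hfix]
      · rintro rfl
        exact hPover
    have hncard : (p.primesOver (𝓞 K)).ncard = 1 := by rw [hset, Set.ncard_singleton]
    rw [hncard, one_mul] at hefg
    have hfac' : p.map (algebraMap ℤ (𝓞 K)) = P ^ p.ramificationIdxIn (𝓞 K) := by
      rw [hfac]
      simp only [hset, Set.toFinset_singleton, Finset.prod_singleton, hein P hPover]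
    rw [hfix, hfac', ← pow_mul, hefg, sq]
  · -- `q O_K = P · τP`, `e = f = 1`
    have hne : P ≠ τ • P := fun h => hfix h.symm
    have hset : p.primesOver (𝓞 K) = {P, τ • P} := by
      symm
      refine Set.eq_of_subset_of_ncard_le ?_ ?_ (IsDedekindDomain.primesOver_finite p (𝓞 K))
      · intro Q hQ
        rcases hQ with rfl | rfl
        · exact hPover
        · exact hτP
      · rw [Set.ncard_pair hne]
        have h1 : 1 ≤ p.ramificationIdxIn (𝓞 K) * p.inertiaDegIn (𝓞 K) :=
          Nat.one_le_iff_ne_zero.mpr (mul_ne_zero he0 hf0)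
        nlinarith [hefg, h1]
    have hncard : (p.primesOver (𝓞 K)).ncard = 2 := by rw [hset, Set.ncard_pair hne]
    rw [hncard] at hefg
    have hef : p.ramificationIdxIn (𝓞 K) * p.inertiaDegIn (𝓞 K) = 1 := by omega
    have he1 : p.ramificationIdxIn (𝓞 K) = 1 := Nat.eq_one_of_mul_eq_one_right hef
    have hf1 : p.inertiaDegIn (𝓞 K) = 1 := Nat.eq_one_of_mul_eq_one_left hef
    have hfac' : p.map (algebraMap ℤ (𝓞 K)) = P * τ • P := by
      rw [hfac]
      simp only [hset, Set.toFinset_insert, Set.toFinset_singleton]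
      rw [Finset.prod_insert (by simpa using hne), Finset.prod_singleton, hein P hPover,
        hein (τ • P) hτP, he1, pow_one, pow_one]
    rw [hf1, pow_one, hfac']

/-- **`I · I^τ = (N I)` for every ideal of a quadratic field** (Cox, Lemma 7.14 (i): «`a ā = N(a) O`»), from the prime case by
unique factorisation. [cite: Cox2013, §7.B Lemma 7.14] -/
private theorem mul_smul_eq_span_absNorm (h2 : finrank ℚ K = 2) (τ : K ≃ₐ[ℚ] K) (hτ : τ ≠ 1)
    (I : Ideal (𝓞 K)) : I * τ • I = Ideal.span {((Ideal.absNorm I : ℕ) : 𝓞 K)} := by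
  classical
  induction I using UniqueFactorizationMonoid.induction_on_prime with
  | h₁ =>
    rw [Ideal.zero_eq_bot, Ideal.bot_mul, Ideal.absNorm_bot, Nat.cast_zero, Ideal.span_singleton_zero]
  | h₂ I hI =>
    rw [Ideal.isUnit_iff] at hI
    subst hI
    have htop : τ • (⊤ : Ideal (𝓞 K)) = ⊤ := Ideal.map_top _
    rw [htop, Ideal.top_mul, Ideal.absNorm_top, Nat.cast_one, Ideal.span_singleton_one]
  | h₃ I P hI0 hP ih =>
    have hP0 : P ≠ ⊥ := hP.ne_zero
    haveI : P.IsPrime := Ideal.isPrime_of_prime hP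
    rw [smul_mul', mul_mul_mul_comm, prime_mul_smul_eq_span_absNorm h2 τ hτ P hP0, ih, map_mul,
      Nat.cast_mul, Ideal.span_singleton_mul_span_singleton]

end ConjNorm

section KRForm

variable {k : Type} [Field k] {n : ℕ}

/-! ### The form `( , )` in coordinates: linearity bookkeeping -/

/-- `(u + u', v) = (u, v) + (u', v)`. [folklore] -/
private theorem krForm_add_left (σ : k →+* k) (J : Matrix (Fin n) (Fin n) k) (u u' v : Fin n → k) :
    krForm σ J (u + u') v = krForm σ J u v + krForm σ J u' v := by
  simp only [krForm, Matrix.mulVec_add, dotProduct_add]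

/-- `(u, v + v') = (u, v) + (u, v')`. [folklore] -/
private theorem krForm_add_right (σ : k →+* k) (J : Matrix (Fin n) (Fin n) k) (u v v' : Fin n → k) :
    krForm σ J u (v + v') = krForm σ J u v + krForm σ J u v' := by
  have h : (σ ∘ (v + v') : Fin n → k) = σ ∘ v + σ ∘ v' := by
    funext i
    simp only [Function.comp_apply, Pi.add_apply, map_add]
  simp only [krForm, h, add_dotProduct]

/-- `(a u, v) = a (u, v)`. [folklore] -/
private theorem krForm_smul_left (σ : k →+* k) (J : Matrix (Fin n) (Fin n) k) (a : k) (u v : Fin n → k) :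
    krForm σ J (a • u) v = a * krForm σ J u v := by
  simp only [krForm, Matrix.mulVec_smul, dotProduct_smul, smul_eq_mul]

/-- `(u, b v) = σ(b) (u, v)`. [folklore] -/
private theorem krForm_smul_right (σ : k →+* k) (J : Matrix (Fin n) (Fin n) k) (b : k) (u v : Fin n → k) :
    krForm σ J u (b • v) = σ b * krForm σ J u v := by
  have h : (σ ∘ (b • v) : Fin n → k) = σ b • (σ ∘ v) := by
    funext i
    simp only [Function.comp_apply, Pi.smul_apply, smul_eq_mul, map_mul]
  simp only [krForm, h, smul_dotProduct, smul_eq_mul]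

/-- `( , )` for the Gram matrix `c J` is `c ( , )`. [folklore] -/
private theorem krForm_smul_gram (σ : k →+* k) (c : k) (J : Matrix (Fin n) (Fin n) k) (u v : Fin n → k) :
    krForm σ (c • J) u v = c * krForm σ J u v := by
  simp only [krForm, Matrix.smul_mulVec, dotProduct_smul, smul_eq_mul]

end KRForm

section KR34

variable {k : Type} [Field k] [NumberField k] {n : ℕ}


omit [NumberField k] in
/-- Coercion `O_k → k` is multiplicative. [folklore] -/
private theorem coe_mul' (x y : 𝓞 k) : ((x * y : 𝓞 k) : k) = (x : k) * (y : k) := map_mul (algebraMap (𝓞 k) k) x y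

omit [NumberField k] in
/-- Coercion `O_k → k` is additive. [folklore] -/
private theorem coe_add' (x y : 𝓞 k) : ((x + y : 𝓞 k) : k) = (x : k) + (y : k) := map_add (algebraMap (𝓞 k) k) x y

omit [NumberField k] in
/-- Coercion `O_k → k` on naturals. [folklore] -/
private theorem coe_natCast' (m : ℕ) : ((m : 𝓞 k) : k) = (m : k) := map_natCast (algebraMap (𝓞 k) k) m

omit [NumberField k] in
/-- Coercion `O_k → k` at `1`. [folklore] -/
private theorem coe_one' : ((1 : 𝓞 k) : k) = 1 := map_one (algebraMap (𝓞 k) k)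

omit [NumberField k] in
/-- Coercion `O_k → k` and negation. [folklore] -/
private theorem coe_neg' (x : 𝓞 k) : ((-x : 𝓞 k) : k) = -(x : k) := map_neg (algebraMap (𝓞 k) k) x

/-! ### `L_𝔞 = 𝔞 L` and `𝔞⁻¹` -/

/-- `v ∈ 𝔞 L` iff `𝔞⁻¹ v ⊆ L` (`𝔞 𝔞⁻¹ = O_k`). [folklore] -/
private theorem mem_twistLattice_iff (𝔞 : (FractionalIdeal (𝓞 k)⁰ k)ˣ) (L : Submodule (𝓞 k) (Fin n → k))
    (v : Fin n → k) :
    v ∈ twistLattice 𝔞 L ↔ ∀ a ∈ ((𝔞⁻¹ : (FractionalIdeal (𝓞 k)⁰ k)ˣ) : FractionalIdeal (𝓞 k)⁰ k), a • v ∈ L := by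
  set A : FractionalIdeal (𝓞 k)⁰ k := ↑𝔞 with hAdef
  set A' : FractionalIdeal (𝓞 k)⁰ k := ↑(𝔞⁻¹ : (FractionalIdeal (𝓞 k)⁰ k)ˣ) with hA'def
  have hA'A : A' * A = 1 := by rw [hAdef, hA'def, Units.inv_mul]
  have hAA' : A * A' = 1 := by rw [hAdef, hA'def, Units.mul_inv]
  constructor
  · intro hv a ha
    refine Submodule.smul_induction_on hv ?_ ?_
    · intro b hb l hl
      rw [FractionalIdeal.mem_coe] at hb
      obtain ⟨r, hr⟩ := (FractionalIdeal.mem_one_iff _).mp (hA'A ▸ FractionalIdeal.mul_mem_mul ha hb)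
      rw [← mul_smul, ← hr, algebraMap_smul]
      exact L.smul_mem r hl
    · intro x y hx hy
      rw [smul_add]
      exact L.add_mem hx hy
  · intro h
    have h1 : (1 : k) ∈ A * A' := by
      rw [hAA']
      exact (FractionalIdeal.mem_one_iff _).mpr ⟨1, map_one _⟩
    have key : ∀ r : k, r ∈ A * A' → r • v ∈ twistLattice 𝔞 L := by
      intro r hr
      refine FractionalIdeal.mul_induction_on hr ?_ ?_
      · intro b hb a ha
        rw [mul_smul]
        exact Submodule.smul_mem_smul ((FractionalIdeal.mem_coe (I := A)).mpr hb) (h a ha)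
      · intro x y hx hy
        rw [add_smul]
        exact Submodule.add_mem _ hx hy
    simpa using key 1 h1

/-! ### The Galois conjugate and the norm of `𝔞` -/

/-- The automorphism group of the quadratic field `k` is `{1, σ}`, so `x σ(x) = N_{k/ℚ}(x)`. [folklore] -/
private theorem mul_conj_eq_norm [IsTotallyComplex k] [Algebra.IsQuadraticExtension ℚ k] (x : k) :
    x * conj ℚ k x = algebraMap ℚ k (Algebra.norm ℚ x) := by
  classical
  have hG : Nat.card (k ≃ₐ[ℚ] k) = 2 := by
    rw [IsGalois.card_aut_eq_finrank, Algebra.IsQuadraticExtension.finrank_eq_two (R := ℚ) (S := k)]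
  have hne : (1 : k ≃ₐ[ℚ] k) ≠ conj ℚ k := (conj_ne_one ℚ k).symm
  have huniv : (Finset.univ : Finset (k ≃ₐ[ℚ] k)) = {1, conj ℚ k} := by
    ext σ
    simp only [Finset.mem_univ, Finset.mem_insert, Finset.mem_singleton, true_iff]
    exact eq_one_or_eq_of_card_two hG (conj_ne_one ℚ k) σ
  rw [Algebra.norm_eq_prod_automorphisms ℚ, huniv, Finset.prod_pair hne, AlgEquiv.one_apply]

/-- For an ideal `I` of `O_k`: `i σ(j) ∈ N(I) O_k` for `i, j ∈ I`. [cite: Cox2013, §7.B Lemma 7.14] -/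
private theorem exists_mul_conj_eq [IsTotallyComplex k] [Algebra.IsQuadraticExtension ℚ k] (I : Ideal (𝓞 k)) {i j : 𝓞 k} (hi : i ∈ I)
    (hj : j ∈ I) : ∃ r : 𝓞 k, (i : k) * conj ℚ k (j : k) = ((Ideal.absNorm I : ℕ) : k) * (r : k) := by
  have hmem : i * conj ℚ k • j ∈ I * conj ℚ k • I := Ideal.mul_mem_mul hi (Ideal.smul_mem_pointwise_smul _ _ _ hj)
  rw [mul_smul_eq_span_absNorm (Algebra.IsQuadraticExtension.finrank_eq_two (R := ℚ) (S := k)) (conj ℚ k)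
    (conj_ne_one ℚ k) I, Ideal.mem_span_singleton'] at hmem
  obtain ⟨r, hr⟩ := hmem
  refine ⟨r, ?_⟩
  have h := congrArg (fun z : 𝓞 k => (z : k)) hr
  simp only [coe_mul'] at h
  rw [mul_comm ((Ideal.absNorm I : ℕ) : k), ← coe_natCast', h]
  rfl

/-- For an ideal `I` of `O_k` and `u ∈ k` with `u I ⊆ O_k`: `u N(I) ∈ σ(I)` (from `N(I) ∈ I σ(I)`).
[cite: Cox2013, §7.B Lemma 7.14] -/
private theorem exists_mul_absNorm_eq_conj [IsTotallyComplex k] [Algebra.IsQuadraticExtension ℚ k] (I : Ideal (𝓞 k)) (u : k)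
    (hu : ∀ i ∈ I, ∃ r : 𝓞 k, u * (i : k) = r) :
    ∃ j ∈ I, u * ((Ideal.absNorm I : ℕ) : k) = conj ℚ k (j : k) := by
  set τ := conj ℚ k with hτ
  have hmem : ((Ideal.absNorm I : ℕ) : 𝓞 k) ∈ I * τ • I := by
    rw [mul_smul_eq_span_absNorm (Algebra.IsQuadraticExtension.finrank_eq_two (R := ℚ) (S := k)) τ (conj_ne_one ℚ k) I]
    exact Ideal.mem_span_singleton_self _
  rw [← coe_natCast']
  refine Submodule.mul_induction_on (C := fun r : 𝓞 k => ∃ j ∈ I, u * (r : k) = τ (j : k)) hmem ?_ ?_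
  · intro m hm n' hn'
    have hn : τ⁻¹ • n' ∈ I := Ideal.mem_pointwise_smul_iff_inv_smul_mem.mp hn'
    obtain ⟨r, hr⟩ := hu m hm
    refine ⟨(τ⁻¹ • r) * (τ⁻¹ • n'), I.mul_mem_left _ hn, ?_⟩
    rw [coe_mul', ← mul_assoc, hr, coe_mul', map_mul]
    congr 1
    · show (r : k) = τ (τ⁻¹ (r : k))
      rw [AlgEquiv.aut_inv, AlgEquiv.apply_symm_apply]
    · show (n' : k) = τ (τ⁻¹ (n' : k))
      rw [AlgEquiv.aut_inv, AlgEquiv.apply_symm_apply]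
  · rintro x y ⟨j₁, hj₁, h₁⟩ ⟨j₂, hj₂, h₂⟩
    refine ⟨j₁ + j₂, I.add_mem hj₁ hj₂, ?_⟩
    rw [coe_add', mul_add, h₁, h₂, coe_add', map_add]

/-- **(3.4) (i)**: `x̃ ∈ Hom_{O_k}(L_{0,𝔞⁻¹}, L)` iff `x̃(1) ∈ 𝔞 L`. [cite: KudlaRapoport2013, §3.3 (3.4) (arXiv v2 p. 18)] -/
private theorem part_i (L : Submodule (𝓞 k) (Fin n → k)) (𝔞 : (FractionalIdeal (𝓞 k)⁰ k)ˣ)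
    (x : Matrix (Fin n) (Fin 1) k) : x ∈ homLattice (idealLattice 𝔞⁻¹) L ↔ colVec x ∈ twistLattice 𝔞 L := by
  rw [mem_twistLattice_iff]
  have hmv : ∀ a : k, x *ᵥ (fun _ : Fin 1 => a) = a • colVec x := by
    intro a
    funext i
    simp only [Matrix.mulVec, dotProduct, Fin.sum_univ_one, Pi.smul_apply, smul_eq_mul, colVec, mul_comm]
  have hmem : ∀ c : Fin 1 → k, c ∈ idealLattice 𝔞⁻¹ ↔
      ∃ a ∈ ((𝔞⁻¹ : (FractionalIdeal (𝓞 k)⁰ k)ˣ) : FractionalIdeal (𝓞 k)⁰ k), (fun _ : Fin 1 => a) = c := by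
    intro c
    simp only [idealLattice, Submodule.mem_map, FractionalIdeal.mem_coe]
    constructor
    · rintro ⟨a, ha, rfl⟩
      exact ⟨a, ha, by funext i; simp⟩
    · rintro ⟨a, ha, rfl⟩
      exact ⟨a, ha, by funext i; simp⟩
  constructor
  · intro h a ha
    rw [← hmv]
    exact h _ ((hmem _).mpr ⟨a, ha, rfl⟩)
  · intro h c hc
    obtain ⟨a, ha, rfl⟩ := (hmem c).mp hc
    rw [hmv]
    exact h a ha

/-- **(3.4) (ii)**: `h̃(x̃, ỹ) = (x̃(1), ỹ(1))_𝔞` with `( , )_𝔞 = ( , )/N(𝔞)` and `(1,1)_{V_{0,𝔞⁻¹}} = N(𝔞⁻¹)⁻¹ = N(𝔞)`.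
[cite: KudlaRapoport2013, §3.3 (3.3)–(3.4) (arXiv v2 p. 18)] -/
private theorem part_ii (σ : k →+* k) (J : Matrix (Fin n) (Fin n) k) (𝔞 : (FractionalIdeal (𝓞 k)⁰ k)ˣ)
    (x y : Matrix (Fin n) (Fin 1) k) :
    hTilde σ J (idealGram 𝔞⁻¹) x y = krForm σ (twistGram 𝔞 J) (colVec x) (colVec y) := by
  have hinv : (((𝔞⁻¹ : (FractionalIdeal (𝓞 k)⁰ k)ˣ) : FractionalIdeal (𝓞 k)⁰ k)) = (𝔞 : FractionalIdeal (𝓞 k)⁰ k)⁻¹ :=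
    Units.val_inv_eq_inv_val 𝔞
  simp only [hTilde, idealGram, Matrix.of_apply, twistGram, krForm_smul_gram, hinv, map_inv₀, inv_inv]
  rw [mul_comm]

/-- **(3.4) (iii)**: «`L_𝔞` is again a self-dual lattice» for `( , )_𝔞 = ( , )/N(𝔞)` — via `𝔞 σ(𝔞) = (N𝔞)`.
[cite: KudlaRapoport2013, §3.3 (3.3)–(3.4) (arXiv v2 p. 18)] -/
private theorem part_iii [IsTotallyComplex k] [Algebra.IsQuadraticExtension ℚ k] (J : Matrix (Fin n) (Fin n) k)
    (L : Submodule (𝓞 k) (Fin n → k)) (𝔞 : (FractionalIdeal (𝓞 k)⁰ k)ˣ)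
    (hsd : IsSelfDualFor (conj ℚ k : k →+* k) J L) :
    IsSelfDualFor (conj ℚ k : k →+* k) (twistGram 𝔞 J) (twistLattice 𝔞 L) := by
  classical
  set σ : k →+* k := (conj ℚ k : k →+* k) with hσdef
  have hσ : ∀ z, σ z = conj ℚ k z := fun z => rfl
  set A : FractionalIdeal (𝓞 k)⁰ k := ↑𝔞 with hAdef
  set A' : FractionalIdeal (𝓞 k)⁰ k := ↑(𝔞⁻¹ : (FractionalIdeal (𝓞 k)⁰ k)ˣ) with hA'def
  have hA'A : A' * A = 1 := by rw [hAdef, hA'def, Units.inv_mul]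
  have hA0 : A ≠ 0 := by rw [hAdef]; exact 𝔞.ne_zero
  -- `A = c · I`, `c = d⁻¹`
  obtain ⟨d, I, hd0, hAI⟩ := FractionalIdeal.exists_eq_spanSingleton_mul A
  set c : k := (algebraMap (𝓞 k) k d)⁻¹ with hcdef
  have hdk : (algebraMap (𝓞 k) k d) ≠ 0 := fun h => hd0 ((map_eq_zero_iff _ (RingOfIntegers.coe_injective)).mp h)
  have hc0 : c ≠ 0 := inv_ne_zero hdk
  have memA : ∀ y : k, y ∈ A ↔ ∃ i ∈ I, y = c * (i : k) := by
    intro y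
    rw [hAI, FractionalIdeal.mem_singleton_mul]
    constructor
    · rintro ⟨y', hy', rfl⟩
      obtain ⟨i, hi, rfl⟩ := (FractionalIdeal.mem_coeIdeal _).mp hy'
      exact ⟨i, hi, rfl⟩
    · rintro ⟨i, hi, rfl⟩
      exact ⟨(i : k), (FractionalIdeal.mem_coeIdeal _).mpr ⟨i, hi, rfl⟩, rfl⟩
  -- norms: `N(A) = |N(c)| N(I)`, `c σ(c) = N(c)`
  set N : ℚ := FractionalIdeal.absNorm A with hNdef
  set Nk : k := algebraMap ℚ k N with hNkdef
  set nI : k := ((Ideal.absNorm I : ℕ) : k) with hnIdef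
  set ν : k := algebraMap ℚ k (Algebra.norm ℚ c) with hνdef
  have hN0 : N ≠ 0 := fun h => hA0 (FractionalIdeal.absNorm_eq_zero_iff.mp h)
  have hNk0 : Nk ≠ 0 := by rw [hNkdef]; exact (map_ne_zero _).mpr hN0
  have hcν : c * conj ℚ k c = ν := mul_conj_eq_norm c
  have hNabs : N = |Algebra.norm ℚ c| * (Ideal.absNorm I : ℚ) := by
    rw [hNdef, hAI, map_mul, FractionalIdeal.absNorm_span_singleton, FractionalIdeal.coeIdeal_absNorm]
  obtain ⟨ε, hε1, hNk⟩ : ∃ ε : 𝓞 k, (ε : k) * ε = 1 ∧ Nk = (ε : k) * (ν * nI) := by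
    rcases abs_choice (Algebra.norm ℚ c) with h | h
    · refine ⟨1, by rw [coe_one', one_mul], ?_⟩
      rw [hNkdef, hNabs, h, map_mul, map_natCast, ← hνdef, ← hnIdef, coe_one', one_mul]
    · refine ⟨-1, by rw [coe_neg', coe_one']; ring, ?_⟩
      rw [hNkdef, hNabs, h, map_mul, map_neg, map_natCast, ← hνdef, ← hnIdef, coe_neg', coe_one']
      ring
  have hνnI0 : ν * nI ≠ 0 := by
    intro h
    rw [h, mul_zero] at hNk
    exact hNk0 hNk
  -- the form of `L_𝔞`
  have hform : ∀ u v, krForm σ (twistGram 𝔞 J) u v = Nk⁻¹ * krForm σ J u v := fun u v => by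
    rw [twistGram, krForm_smul_gram]
  intro x
  constructor
  · -- `x ∈ 𝔞 L ⇒ (x, 𝔞 L)/N𝔞 ⊆ O_k`
    intro hx y hy
    rw [hform]
    suffices h : ∃ r : 𝓞 k, krForm σ J x y = Nk * r by
      obtain ⟨r, hr⟩ := h
      exact ⟨r, by rw [hr, ← mul_assoc, inv_mul_cancel₀ hNk0, one_mul]⟩
    revert y
    refine Submodule.smul_induction_on hx ?_ ?_
    · intro a ha l hl y hy
      refine Submodule.smul_induction_on hy ?_ ?_
      · intro b hb m hm
        obtain ⟨i, hi, rfl⟩ := (memA a).mp ((FractionalIdeal.mem_coe (I := A)).mp ha)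
        obtain ⟨j, hj, rfl⟩ := (memA b).mp ((FractionalIdeal.mem_coe (I := A)).mp hb)
        obtain ⟨s, hs⟩ := (hsd l).mp hl m hm
        obtain ⟨r, hr⟩ := exists_mul_conj_eq I hi hj
        refine ⟨ε * (r * s), ?_⟩
        rw [krForm_smul_left, krForm_smul_right, ← hs, hσ, map_mul, coe_mul', coe_mul', hNk]
        have hreg : c * (i : k) * (conj ℚ k c * conj ℚ k (j : k) * algebraMap (𝓞 k) k s)
            = (c * conj ℚ k c) * ((i : k) * conj ℚ k (j : k)) * algebraMap (𝓞 k) k s := by ring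
        rw [hreg, hcν, hr]
        linear_combination (-(ν * nI * (r : k) * algebraMap (𝓞 k) k s)) * hε1
      · intro y₁ y₂ ⟨r₁, h₁⟩ ⟨r₂, h₂⟩
        exact ⟨r₁ + r₂, by rw [krForm_add_right, h₁, h₂, coe_add', mul_add]⟩
    · intro x₁ x₂ h₁ h₂ y hy
      obtain ⟨r₁, hr₁⟩ := h₁ y hy
      obtain ⟨r₂, hr₂⟩ := h₂ y hy
      exact ⟨r₁ + r₂, by rw [krForm_add_left, hr₁, hr₂, coe_add', mul_add]⟩
  · -- `(x, 𝔞 L)/N𝔞 ⊆ O_k ⇒ x ∈ 𝔞 L`: `𝔞⁻¹ x ⊆ L^∨ = L`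
    intro h
    rw [mem_twistLattice_iff]
    intro u hu
    rw [hsd]
    intro l hl
    rw [krForm_smul_left]
    set z := krForm σ J x l with hz
    -- `u c I ⊆ O_k`, so `u c N(I) = σ(j)` for some `j ∈ I`
    have huc : ∀ i ∈ I, ∃ r : 𝓞 k, u * c * (i : k) = r := by
      intro i hi
      have hci : c * (i : k) ∈ A := (memA _).mpr ⟨i, hi, rfl⟩
      obtain ⟨r, hr⟩ := (FractionalIdeal.mem_one_iff _).mp (hA'A ▸ FractionalIdeal.mul_mem_mul hu hci)
      exact ⟨r, by rw [mul_assoc, ← hr]⟩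
    obtain ⟨j, hj, hjeq⟩ := exists_mul_absNorm_eq_conj I (u * c) huc
    -- the hypothesis at `y = (c j) • l ∈ 𝔞 L`
    have hy : (c * (j : k)) • l ∈ twistLattice 𝔞 L :=
      Submodule.smul_mem_smul ((FractionalIdeal.mem_coe (I := A)).mpr ((memA _).mpr ⟨j, hj, rfl⟩)) hl
    obtain ⟨t, ht⟩ := h _ hy
    rw [hform, krForm_smul_right, ← hz, hσ, map_mul] at ht
    -- `u z (ν nI) = σ(j) z σ(c) = t Nk = t ε ν nI`
    have h2 : algebraMap (𝓞 k) k t * Nk = conj ℚ k c * conj ℚ k (j : k) * z := by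
      rw [ht, mul_comm, ← mul_assoc, mul_inv_cancel₀ hNk0, one_mul]
    have key : u * z * (ν * nI) = algebraMap (𝓞 k) k t * ε * (ν * nI) := by
      calc u * z * (ν * nI) = (u * c * nI) * z * conj ℚ k c := by rw [← hcν]; ring
        _ = conj ℚ k (j : k) * z * conj ℚ k c := by rw [hjeq]
        _ = algebraMap (𝓞 k) k t * Nk := by rw [h2]; ring
        _ = algebraMap (𝓞 k) k t * ε * (ν * nI) := by rw [hNk]; ring
    have huz : u * z = algebraMap (𝓞 k) k t * ε := mul_right_cancel₀ hνnI0 key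
    exact ⟨t * ε, by rw [huz, map_mul]⟩

/-- ★ `KR2013_3_eq_3_4` HOLDS. [KudlaRapoport2013, §3.3 (3.4) (arXiv v2 p. 18)]: «Then, `L_𝔞` is again a self-dual lattice,
`L_𝔞 ≃ Hom_{O_k}(L_{0,𝔞⁻¹}, L)` as hermitian lattices» — (i) `x̃ ∈ Hom_{O_k}(L_{0,𝔞⁻¹}, L) ⇔ x̃(1) ∈ 𝔞 L` (`𝔞 𝔞⁻¹ = O_k`);
(ii) `h̃(x̃, ỹ) = (x̃(1), ỹ(1))/N(𝔞)` (`N(𝔞⁻¹) = N(𝔞)⁻¹`); (iii) `(𝔞 L)^∨ = 𝔞 L` for `( , )/N(𝔞)`, by the quadratic-field identity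
`𝔞 · 𝔞^σ = (N𝔞)` (Cox, Lemma 7.14, from `e f g = 2` prime by prime). [cite: KudlaRapoport2013, §3.3 (3.4) (arXiv v2 p. 18)]
[cite: Cox2013, §7.B Lemma 7.14] -/
theorem KR2013_3_eq_3_4_holds : KR2013_3_eq_3_4 := by
  intro k _ _ _ _ n J L 𝔞
  exact ⟨fun x => part_i L 𝔞 x, fun x y => part_ii _ J 𝔞 x y, fun _ _ hsd => part_iii J L 𝔞 hsd⟩

end KR34

end Literature.AlgebraicGeometry.ShimuraVarieties.KudlaRapoport2013.Sec3ComplexUniformization
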